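import Summits.BirchSwinnertonDyer.BirchSwinnertonDyer.Theorems.AdditiveBranchIMCGordTwoTwistedFrame
import Literature.NumberTheory.EllipticCurves.Hsieh2014.AnticyclotomicPAdicLFunctionRamifiedTwistedSteinbergAtTwo
import HarnessLib

/-!
# Route `AdditiveBranchIMC`, crux `GordTwoRankZeroOffCaseOne` (19357), line `three_field_road`, DOOR D («`ℓ₀ = 2` as the `K`-ramified twisted
# Wan prime», LeadReport27 §5): the ♭-frame of unit content and the anticyclotomic restriction at the DYADIC twisted-road configuration
# (LEAD g19; `--supports` 19357, helper only)

Theorems only (no definition, no named fact, no `sorry`); nothing about BSD is asserted and the crux stays OPEN. The `ℓ₀ = 2` siblings of §2–§3 of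
`AdditiveBranchIMCGordTwoTwistedFrame.lean` (LEAD g16, p-numbers there), VERBATIM with the odd twisted-road configuration (S4‴) «`ℓ₀ ≠ p`, `ℓ₀ ≠ 2`,
`ℓ₀ ∣ d_K`, `W^{(ℓ₀*)}` multiplicative at `ℓ₀`, `E/K` non-split multiplicative above `ℓ₀`, every other `ℓ ∣ N` split, `p ∤ ℓ₀ + 1`» REPLACED by the
dyadic configuration (S4⁗) of the typed reading R3₂ (wi-101332, `Hsieh2014.thmB_exists_isHsiehLFunction_coeff_norm_eq_one_unrPeriod_ramifiedTwistedSteinbergAtTwo`):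
«`t ∈ {−1, 2, −2}`, `2 ∣ d_K`, `W₁ = W^{(t)}` multiplicative at `2`, `E/K` non-split multiplicative above `2`, every ODD `ℓ ∣ N` split, `p ∤ 2 + 1`».
(§1's base-change clause at `2` is p814401 `baseChange_nonsplit_two_of_dyadicClass`, read through the door-D predicates in
`AdditiveBranchIMCGordTwoTwistedWanTwoDefs.lean`; it is an INPUT here, as in the odd file.)

* `exists_frameInt_unitContent_twisted_two` — a ♭-frame `(Ω_K ≠ 0, Ω_p ∈ R₀ˣ, Q ∈ 𝓞_{ℂ_p}⟦T⟧)` with `R1.IsBDPLFunctionInt p ι′ 𝔭 κ γ f_E Ω_K Ω_p Q`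
  AND a unit coefficient, from Hsieh 2014 Thm. B in the dyadic twisted reading (R3₂, `f_E`-keyed frame, first cut `p ∤ 2 + 1`, i.e. `p ≠ 3`) through
  the λ-supply and the Hsieh→Castella glue.
* `exists_frame_and_restriction_twisted_two` — the anticyclotomic restriction `A(0,·) = B(0,·)·D`, `D ≠ 0`, `(D) ⊆ (Q′)` of a CLW pair at the dyadic
  twisted-road configuration (the frame above, then the road-prime-free `TameAnticycRestriction.exists_constantCoeff_eq_mul`).

References: Hsieh, Doc. Math. 19 (2014) Thm. B [p. 713; arXiv:1112.1580 p. 3 l. 24 («p odd» the only parity clause), p. 4 ll. 13–22 ((sf), ramified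
`𝔫⁻` in scope)]; Castella–Liu–Wan 2022 (1.0.3), Thm. 8.2.1; Castella 2018 Thm. 3.1. presearch: n/a (kernel port over a typed reading; no new printed
input; pen e21 §2 (ii) is the print audit of the dyadic configuration). BSD is proved for no curve.
-/

noncomputable section

open scoped Classical

set_option linter.dupNamespace false
set_option autoImplicit false

open NumberField IsDedekindDomain IsDedekindDomain.HeightOneSpectrum Rat.HeightOneSpectrum Field PowerSeries
open WeierstrassCurve Literature.NumberTheory.EllipticCurves
  Literature.NumberTheory.EllipticCurves.ModularForms
  Literature.NumberTheory.EllipticCurves.Rank1Residual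
  Literature.NumberTheory.EllipticCurves.Rank1Residual.Typed
  Literature.NumberTheory.EllipticCurves.GreenbergVatsal2000
  Literature.NumberTheory.EllipticCurves.CastellaLiuWan2022
  Literature.NumberTheory.GaloisRepresentations
  Literature.NumberTheory.GaloisCohomology
open Summit.BirchSwinnertonDyer.Rank1Residual
open Summit.BirchSwinnertonDyer.Rank1Residual.Additive
open Summit.BirchSwinnertonDyer.Rank1Residual.X11b
open Summit.BirchSwinnertonDyer.BirchSwinnertonDyer.Theorems

namespace Summit.BirchSwinnertonDyer.BirchSwinnertonDyer.Theorems.TwistedWanRoad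

/-! ## §2₂ A ♭-frame of UNIT content over a DYADIC twisted-road configuration (Hsieh 2014 Thm. B, reading R3₂) -/

/-- **A ♭-frame OF UNIT CONTENT EXISTS over a dyadic twisted-road configuration** (the `ℓ₀ = 2` sibling of
`exists_frameInt_unitContent_twisted`, (S4‴) ↦ (S4⁗)): for every embedding datum `ι′` inducing `𝔭`, Hsieh 2014 Thm. B in the dyadic
twisted-Steinberg reading (`hB`; (irr_K) supplied as `hirr`) gives `Ω_K ≠ 0`, `Ω_p ∈ R₀ˣ` and `Q ∈ 𝓞_{ℂ_p}⟦T⟧` with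
`R1.IsBDPLFunctionInt p ι′ 𝔭 κ γ f Ω_K Ω_p Q` AND a unit coefficient, for any newform `f` of `W` of level `N`, `p ∣ N` odd, `t ∈ {−1, 2, −2}` with
`2 ∣ d_K`, `W^{(t)}` multiplicative at `2`, `E/K` non-split multiplicative above `2`, every odd `ℓ ∣ N` split, `p ∤ 2 + 1`
(λ-supply `X11b.lambdaSupplyAt`; glue `X11b.exists_isBDPLFunctionInt_of_isHsiehLFunction` multiplies by a constant of norm one).
CONDITIONAL on `hB`. [cite: Hsieh2014, Thm. B p. 713 (Doc. Math. 19) = Thm. 2 (arXiv:1112.1580 p. 4), Thm. 6.2 (p. 25)]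
[cite: Castella2018, Thm. 3.1 (arXiv:1704.06608 p. 9) (shape)] -/
theorem exists_frameInt_unitContent_twisted_two {p : ℕ} [Fact p.Prime]
    (hB : Hsieh2014.thmB_exists_isHsiehLFunction_coeff_norm_eq_one_unrPeriod_ramifiedTwistedSteinbergAtTwo)
    (W : WeierstrassCurve ℚ) [W.IsElliptic]
    (K : Type) [Field K] [NumberField K] (𝔭 : HeightOneSpectrum (𝓞 K))
    (κ : ZpExtension K p) (γ : absoluteGaloisGroup K) [Fact (κ.IsTopGenerator γ)] {N : ℕ} [NeZero N]
    (f : CuspForm (CongruenceSubgroup.Gamma0 N) 2) (hfW : IsNewformOf W f) (t : ℤ)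
    (hp2 : p ≠ 2) (hpN : p ∣ N) (hK : IsImaginaryQuadratic K)
    (hsplit : ((Ideal.span {(p : ℤ)}).primesOver (𝓞 K)).ncard = 2)
    (h𝔭 : ((p : ℕ) : 𝓞 K) ∈ 𝔭.asIdeal)
    (ht : t = -1 ∨ t = 2 ∨ t = -2) (h2d : (2 : ℤ) ∣ NumberField.discr K)
    (hmult₂ : (W.quadraticTwist (t : ℚ)).HasMultiplicativeReductionAtPrime 2)
    (hbc : ∀ v : HeightOneSpectrum (𝓞 K), ((2 : ℕ) : 𝓞 K) ∈ v.asIdeal →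
      (W.baseChange K).HasMultiplicativeReductionAt v ∧ ¬ (W.baseChange K).HasSplitMultiplicativeReductionAt v)
    (hsplitq : ∀ ℓ : ℕ, ℓ.Prime → ℓ ∣ N → ℓ ≠ 2 → ((Ideal.span {(ℓ : ℤ)}).primesOver (𝓞 K)).ncard = 2)
    (hcut : ¬ p ∣ 2 + 1)
    (hirr : ∀ ρ : ModPGaloisRep K (ZMod p) 2, (W.baseChange K).IsTorsionGaloisRep p ρ →
      FramedRep.IsAbsolutelyIrreducible ρ)
    (hκ : κ.IsAnticyclotomic) (ι' : PadicAlgCl p ≃+* ℂ)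
    (hι' : ∀ (w : InfinitePlace K) (k : 𝓞 K), k ∈ 𝔭.asIdeal ↔ ‖ι'.symm (w.embedding (k : K))‖ < 1) :
    ∃ (ΩK : ℂ) (Ωp : (unrIntegers p)ˣ) (Q : PowerSeries (PadicComplexInt p)), ΩK ≠ 0 ∧
      R1.IsBDPLFunctionInt p ι' 𝔭 κ γ f ΩK ((Ωp : unrIntegers p) : ℂ_[p]) Q ∧ HasUnitContent Q := by
  have hγ : κ.IsTopGenerator γ := Fact.out
  obtain ⟨lam, rlam, hunit, hinfl, hAQ, hunrl, havl, hfacl⟩ := lambdaSupplyAt hp2 ι' K κ hK hκ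
  obtain ⟨A, ΩK₀, C, Ωp, Q₀, hA0, hΩK₀, hC, hQ₀, n, hn⟩ :=
    hB ι' K 𝔭 κ γ W f t lam rlam hp2 hfW hK hsplit h𝔭 hι' ht h2d hmult₂ hbc hsplitq hcut hirr hunit
      hinfl hAQ hunrl havl hfacl hκ hγ
  obtain ⟨ΩK, c, hΩK, hc, hQ⟩ :=
    exists_isBDPLFunctionInt_of_isHsiehLFunction ι' 𝔭 κ γ f hpN hA0 hΩK₀ hC
      ((Ωp : unrIntegers p) : ℂ_[p]) hQ₀
  refine ⟨ΩK, Ωp, _, hΩK, hQ, n, ?_⟩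
  rw [PowerSeries.coeff_C_mul]
  exact (isUnit_padicComplexInt_of_norm_eq_one hc).mul (isUnit_padicComplexInt_of_norm_eq_one hn)

/-! ## §3₂ The anticyclotomic restriction of a CLW pair over a DYADIC twisted-road configuration -/

/-- **The anticyclotomic restriction of a CLW pair at a DYADIC twisted-road configuration** (the `ℓ₀ = 2` sibling of
`exists_frame_and_restriction_twisted`): for `W/ℚ` globally minimal with `p ≥ 5` additive (`Addv W p`), `ρ̄_{E,p}` onto, `K` imaginary quadratic
with `p` split, `t ∈ {−1, 2, −2}` with `2` RAMIFIED in `K`, `W^{(t)}` multiplicative at `2`, `E/K` non-split multiplicative above `2`, every odd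
`ℓ ∣ N` split, and Hsieh 2014 Thm. B (dyadic twisted reading R3₂) as `hB`: for every anticyclotomic datum `(κ, γ, 𝔭, 𝔭′, ι′)` with `𝔭` induced by
`ι′`, every completing pair `(κ₁, γ₁)` and every CLW pair `(A, B)` with genuine period data, there are a ♭-frame `(Ω_K′, Ω_p′, Q′)` at
`(ι′, 𝔭, κ, γ, f)` and `D ≠ 0` with `A(0,·) = B(0,·)·D`, `(D) ⊆ (Q′)` (§2₂'s unit-content frame — the cut `p ∤ 2 + 1` is automatic for `p ≥ 5` —,
then `TameAnticycRestriction.exists_constantCoeff_eq_mul`). CONDITIONAL on `hB`.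
[cite: Hsieh2014, Thm. B p. 713 (Doc. Math. 19)] [cite: CastellaLiuWan2022, (1.0.3) p. 3 and Thm. 8.2.1 p. 85 (Forum Math. Sigma 10 (2022) e110)]
[cite: Castella2018, Thm. 3.1 (arXiv:1704.06608 p. 9)] -/
theorem exists_frame_and_restriction_twisted_two
    (hB : Hsieh2014.thmB_exists_isHsiehLFunction_coeff_norm_eq_one_unrPeriod_ramifiedTwistedSteinbergAtTwo)
    (W : WeierstrassCurve ℚ) [W.IsElliptic] (p : ℕ) [Fact p.Prime] (K : Type) [Field K] [NumberField K]
    [W.IsGloballyMinimal] (hp5 : 5 ≤ p) (hadd : Addv W p) (hsurj : Surj W p) (hK : IsImaginaryQuadratic K)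
    (hsplit : ((Ideal.span {(p : ℤ)}).primesOver (𝓞 K)).ncard = 2)
    {t : ℤ} (ht : t = -1 ∨ t = 2 ∨ t = -2) (h2d : (2 : ℤ) ∣ NumberField.discr K)
    (hmult₂ : (W.quadraticTwist (t : ℚ)).HasMultiplicativeReductionAtPrime 2)
    (hbc : ∀ v : HeightOneSpectrum (𝓞 K), ((2 : ℕ) : 𝓞 K) ∈ v.asIdeal →
      (W.baseChange K).HasMultiplicativeReductionAt v ∧ ¬ (W.baseChange K).HasSplitMultiplicativeReductionAt v)
    (hsplitq : ∀ ℓ : ℕ, ℓ.Prime → ℓ ∣ W.conductorNorm ℤ → ℓ ≠ 2 →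
      ((Ideal.span {(ℓ : ℤ)}).primesOver (𝓞 K)).ncard = 2)
    {N : ℕ} [NeZero N] (Dt : ModularParametrizationData W N) (hN : W.conductorNorm ℤ = N)
    (κ : ZpExtension K p) (hκ : κ.IsAnticyclotomic) (γ : absoluteGaloisGroup K) [hγ : Fact (κ.IsTopGenerator γ)]
    (𝔭 : HeightOneSpectrum (𝓞 K)) (h𝔭 : ((p : ℕ) : 𝓞 K) ∈ 𝔭.asIdeal) (𝔭' : HeightOneSpectrum (𝓞 K))
    (ι' : PadicAlgCl p ≃+* ℂ)
    (hind : ∀ (w : InfinitePlace K) (k : 𝓞 K), k ∈ 𝔭.asIdeal ↔ ‖ι'.symm (w.embedding (k : K))‖ < 1)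
    (κ₁ : ZpExtension K p) (γ₁ : absoluteGaloisGroup K) [hpair : Fact (ZpExtension.IsTopGeneratorPair κ₁ κ γ₁ γ)]
    (Ωinf C : ℂ) (Ωp : (unrIntegers p)ˣ) (A B : PowerSeries (PowerSeries (PadicComplexInt p)))
    (hΩinf : Ωinf ≠ 0) (hC : ‖((ι'.symm C : PadicAlgCl p) : ℂ_[p])‖ = 1)
    (hAB : IsCastellaLiuWanLFunction₂ ι' 𝔭' κ₁ κ γ₁ γ Dt.f Ωinf C ((Ωp : unrIntegers p) : ℂ_[p]) A B) :
    ∃ (ΩK' : ℂ) (Ωp' : ℂ_[p]) (Q' D : PowerSeries (PadicComplexInt p)),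
      ΩK' ≠ 0 ∧ Ωp' ≠ 0 ∧ R1.IsBDPLFunctionInt p ι' 𝔭 κ γ Dt.f ΩK' Ωp' Q' ∧
      PowerSeries.constantCoeff A = PowerSeries.constantCoeff B * D ∧ D ≠ 0 ∧
        Ideal.span {D} ≤ Ideal.span {Q'} := by
  have hp : p.Prime := Fact.out
  have hp2 : p ≠ 2 := by omega
  have h2 : Module.finrank ℚ K = 2 := hK.1
  -- `a_p(f) = 0`, `p ∣ N`
  have hap : cuspCoeff Dt.f p = 0 := by
    rw [Dt.isNewformOf.2 p, W.LFunction_apply_eq_zero_of_not_good_of_not_mult p hadd.1 hadd.2 (dvd_refl p),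
      Int.cast_zero]
  have hpN : p ∣ N := by
    rw [← hN]; exact (W.dvd_conductorNorm_iff_not_hasGoodReductionAtPrime p).mpr hadd.1
  have hsplitq' : ∀ ℓ : ℕ, ℓ.Prime → ℓ ∣ N → ℓ ≠ 2 → ((Ideal.span {(ℓ : ℤ)}).primesOver (𝓞 K)).ncard = 2 := by
    rw [← hN]; exact hsplitq
  -- the unit cut at `ℓ₀ = 2` is automatic: `p ∤ 3` for `p ≥ 5`
  have hcut : ¬ p ∣ 2 + 1 := fun h ↦ by
    have := Nat.le_of_dvd (by norm_num) h
    omega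
  -- (irr_K) from `Surj`
  have hirr : ∀ ρ : ModPGaloisRep K (ZMod p) 2, (W.baseChange K).IsTorsionGaloisRep p ρ →
      FramedRep.IsAbsolutelyIrreducible ρ :=
    fun ρ hρ ↦ SignedBaseChangeK1FrameData.irrK_framed_of_surj W p hp2 hsurj K h2 ρ hρ
  -- the ♭-frame of unit content (Hsieh Thm. B, dyadic twisted reading R3₂)
  obtain ⟨ΩK', Ωp', Q', hΩK', hQ', hμ⟩ :=
    exists_frameInt_unitContent_twisted_two hB W K 𝔭 κ γ Dt.f Dt.isNewformOf t hp2 hpN hK hsplit h𝔭 ht h2d hmult₂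
      hbc hsplitq' hcut hirr hκ ι' hind
  have hΩp'0 : ((Ωp' : unrIntegers p) : ℂ_[p]) ≠ 0 := fun h ↦ Ωp'.ne_zero (by exact_mod_cast h)
  have hΩp0 : ((Ωp : unrIntegers p) : ℂ_[p]) ≠ 0 := fun h ↦ Ωp.ne_zero (by exact_mod_cast h)
  have hQ'0 : Q' ≠ 0 := by
    obtain ⟨n, hn⟩ := hμ
    intro h
    rw [h, map_zero] at hn
    exact not_isUnit_zero hn
  obtain ⟨D, hAD, hD0, hDQ⟩ := TameAnticycRestriction.exists_constantCoeff_eq_mul hp2 hK hpN hap hκ hγ.out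
    (Fact.out : ZpExtension.IsTopGeneratorPair κ₁ κ γ₁ γ).apply_left hΩinf hC hΩK' hΩp0 hΩp'0 hAB hQ'
  exact ⟨ΩK', _, Q', D, hΩK', hΩp'0, hQ', hAD, hD0 hQ'0, hDQ⟩

end Summit.BirchSwinnertonDyer.BirchSwinnertonDyer.Theorems.TwistedWanRoad

end
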